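import Literature.Combinatorics.Enumerative.HafnianGeneratingFunction
import Literature.Analysis.Matrix.PermanentHadamard
import HarnessLib

/-!
# Venture HSemireg — the hafnian law for permanents of rank-two alternating («bracket») matrices, part 1/2: the permanent and hafnian lemmas

Part of the Lean index of the computation cell `pub-hsemireg` (theory seat th-7 gen 8; tree-shaped draft offered to the
enclosure lane p3 / t-7 / p6).  Builds on the tree's `Literature/Combinatorics/Enumerative/Hafnian.lean` /
`HafnianExpansion.lean` / `HafnianGeneratingFunction.lean` (`hafnian`, `perfectMatchings`, `HafnianExpansion.minor`, the row
expansion of the hafnian, `hafnian_submatrix_equiv`).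

For an ALTERNATING form `b : V → V → R` with values in a commutative ring which satisfies the three-term
(Plücker / Grassmann) relation — `b x x = 0`, `b x y = − b y x`,
`b x y · b z w − b x z · b y w + b x w · b y z = 0` (e.g. `b x y = x − y` on `R`, or the bracket
`[p, q] = p₁ q₂ − p₂ q₁` of two vectors of `R²`, i.e. any matrix `(b (r i) (r j))` of rank ≤ 2) — and points
`r : Fin (2m) → V`, the PERMANENT of the alternating matrix `(b (r i) (r j))_{i,j}` is a multiple of the HAFNIAN of the
matrix of SQUARED entries:

  `per (b (r i) (r j))_{i,j < 2m} = (−1)^m · m! · haf ((b (r i) (r j))²)_{i,j < 2m}`   (`hafnian_law`),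

equivalently (`b x y = x − y`): `per (x_i − x_j) = (−1)^m · m! · Σ_{M} Π_{{i,j} ∈ M} (x_i − x_j)²`, the sum over the
perfect matchings `M` of `{0, …, 2m−1}` (`permanent_sub_eq`); for an odd number of points the permanent vanishes
(`permanent_odd`). The BORDERED versions (rows `(a, r)`, columns `(c, r)`) are `even_bordered` and `odd_bordered`:

  `per = (−1)^j (j+1)! · haf((b (r s) (r t))²) · b a c`                         (`r : Fin (2j) → V`),
  `per = (−1)^j (j+1)! · Σ_i b a (r i) · b (r i) c · haf((b (r s) (r t))²)_{s,t ≠ i}`   (`r : Fin (2j+1) → V`).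

Through the polarisation formula `⟨Π ℓ_i, Π m_j⟩_N = per([ℓ_i, m_j]) / N!` for the apolar pairing of binary forms this is
the classical expression of the quadratic (apolar) invariant of a binary form of even degree `2m` as a symmetric function
of ROOT DIFFERENCES, `⟨f, f⟩_{2m} = (−1)^m (m!/(2m)!) Σ_M Π_{ij ∈ M} (α_i − α_j)²` (for the quartic: `I = (1/24) Σ (α−β)²(γ−δ)²`),
whence the SIGN LAW `(−1)^m ⟨f, f⟩_{2m} ≥ 0` for real-rooted `f`, with equality iff a root has multiplicity `> m`
(that translation is NOT formalised here; this file is about permanents and hafnians only).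

HONEST FRAMING (cell `pub-hsemireg`, theory seat th-7): pure finite combinatorics / commutative algebra; nothing here
bears on HC / HC_CM / HC_AV or on any variety. Used by the cell only through the dictionary above (one-sided W-purity law,
theory/FORMULA-N-th7.md §L.11).

## Contents (all proved, 0 named facts)

* Laplace expansion of `Matrix.permanent` along column `0`: NOT re-proved here — the landed
  `Literature.Analysis.Matrix.perm_laplace_col_zero` (PermanentHadamard.lean; [folklore]) is imported and used
  (gate dedup.landed, 2026-08-23; th-7's draft v2 carried a verbatim copy `laplace_col_zero`).
* `P b p q := per (b (p i) (q j))` (two configurations `p q : Fin k → V`), `Asq b p := ((b (p i) (p j))²)`,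
  `Hf b p := haf (Asq b p)`; `P_laplace`, `P_perm_cols`, `P_cons_cons` (the realigned expansion
  `P(cons a r, cons c r) = b a c · P(r,r) + Σ_i b(r_i, c) · P(cons a r∖i, cons r_i r∖i)`), `P_self`, `P_cons_zero`.
* `Hf_reindex`, `hafnian_minor_Asq`, `hafnian_minor_swap`, `card_compl2`, `emb2` (the increasing enumeration of
  `Fin (k+2) ∖ {i, i.succAbove l}`), `hafnian_minor_succAbove`, `Hf_expand_zero` (row-`0` expansion of `Hf` in
  `succAbove` form), `sum_sum_erase_mul_hafnian_minor` (edge-sum identity `Σ_a Σ_{c ≠ a} A_{ac} haf A_{ac} = n · haf A`).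
* `pair_identity` (`F(i,m) + F(m,i) = − b a c · b(r_i,r_m)² · haf(minor)`, one `linear_combination` with the Plücker
  relation), `two_mul_double_sum` (division-free), `double_sum` (uses `IsLeftRegular 2` once).
* `step_FO`, `step_O`, `step_FE`, `step_E`, `even_bordered`, **`hafnian_law`**, `permanent_odd`, **`odd_bordered`**.
* Instances: `permanent_sub_eq`, `permanent_sub_odd` (`b x y = x − y`), `bracket`, `permanent_bracket_eq`,
  `permanent_sub_bordered_even`, `permanent_sub_bordered_odd`.

Hypothesis `IsLeftRegular (2 : R)` in the abstract statements: the proof halves the symmetrised double sum once; for the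
affine instance `b x y = x − y` it is REMOVED by base change from the universal ring `ℤ[X_0, …, X_{2m−1}]`
(`permanent_sub_eq_all`, `permanent_sub_odd_all`, section `BaseChange`: `map_permanent`, `map_hafnian`).  NOT covered: the
abstract form without the `2`-hypothesis, the refinement by number of cycles (`Σ_{σ with k cycles} = (−1)^m c(m,k) · haf`,
`c` = unsigned Stirling numbers), the apolar dictionary.
-/

namespace Summit.Ventures.HSemireg

open Finset Matrix
open Literature.Combinatorics.Enumerative Literature.Combinatorics.Enumerative.HafnianExpansion
  Literature.Combinatorics.Enumerative.HafnianGeneratingFunction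

namespace BracketPermanent

variable {R : Type*} [CommRing R]

variable {V : Type*} (b : V → V → R)

/-- the two-configuration bracket permanent `P(p,q) = per (b (p i) (q j))_{i,j}`. [folklore] -/
def P {k : ℕ} (p q : Fin k → V) : R := (Matrix.of fun i j => b (p i) (q j)).permanent

/-- the squared-bracket matrix of a configuration. [folklore] -/
def Asq {W : Type*} (p : W → V) : Matrix W W R := Matrix.of fun i j => b (p i) (p j) ^ 2

/-- its hafnian `Hf p = haf (b (p i) (p j)^2)`. [folklore] -/
def Hf {W : Type*} [Fintype W] [DecidableEq W] [LinearOrder W] (p : W → V) : R := hafnian (Asq b p)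

section Permanent

/-- `P_laplace` (auxiliary). [folklore] -/
theorem P_laplace {k : ℕ} (p q : Fin (k + 1) → V) :
    P b p q = ∑ i : Fin (k + 1), b (p i) (q 0) * P b (p ∘ i.succAbove) (q ∘ Fin.succ) := by
  unfold P
  rw [Literature.Analysis.Matrix.perm_laplace_col_zero]
  rfl

/-- `P_perm_cols` (auxiliary). [folklore] -/
theorem P_perm_cols {k : ℕ} (p q : Fin k → V) (σ : Equiv.Perm (Fin k)) :
    P b p (q ∘ σ) = P b p q := by
  unfold P
  exact Matrix.permanent_permute_rows σ (Matrix.of fun i j => b (p i) (q j))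

/-- `cons_comp_succ` (auxiliary). [folklore] -/
theorem cons_comp_succ {k : ℕ} (a : V) (r : Fin k → V) :
    (Fin.cons a r : Fin (k + 1) → V) ∘ Fin.succ = r := by
  funext l
  simp only [Function.comp_apply, Fin.cons_succ]

/-- `cons_comp_succ_succAbove` (auxiliary). [folklore] -/
theorem cons_comp_succ_succAbove {k : ℕ} (a : V) (r : Fin (k + 1) → V) (i : Fin (k + 1)) :
    (Fin.cons a r : Fin (k + 2) → V) ∘ i.succ.succAbove = Fin.cons a (r ∘ i.succAbove) := by
  funext l
  refine Fin.cases ?_ (fun l' => ?_) l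
  · simp only [Function.comp_apply, Fin.succ_succAbove_zero, Fin.cons_zero]
  · simp only [Function.comp_apply, Fin.succ_succAbove_succ, Fin.cons_succ]

/-- `self_eq_cons_comp_cycleRange` (auxiliary). [folklore] -/
theorem self_eq_cons_comp_cycleRange {k : ℕ} (r : Fin (k + 1) → V) (i : Fin (k + 1)) :
    r = (Fin.cons (r i) (r ∘ i.succAbove) : Fin (k + 1) → V) ∘ i.cycleRange := by
  rw [Fin.cons_comp_cycleRange]
  exact (Fin.insertNth_self_removeNth i r).symm

/-- the realigned Laplace expansion: `P(cons a r, cons c r) = b a c · P(r,r) + Σ_i b(r_i, c) · P(cons a r∖i, cons r_i r∖i)`. [folklore] -/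
theorem P_cons_cons {k : ℕ} (a c : V) (r : Fin (k + 1) → V) :
    P b (Fin.cons a r) (Fin.cons c r) = b a c * P b r r +
      ∑ i : Fin (k + 1), b (r i) c *
        P b (Fin.cons a (r ∘ i.succAbove)) (Fin.cons (r i) (r ∘ i.succAbove)) := by
  rw [P_laplace, Fin.sum_univ_succ]
  simp only [Fin.cons_zero, Fin.cons_succ, Fin.succAbove_zero, cons_comp_succ]
  congr 1
  refine Finset.sum_congr rfl fun i _ => ?_
  rw [cons_comp_succ_succAbove]
  congr 1
  rw [congrArg (P b (Fin.cons a (r ∘ i.succAbove))) (self_eq_cons_comp_cycleRange r i), P_perm_cols]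

/-- `P(r,r)` through `P_cons_cons`: `r = cons (r 0) (tail r)`. [folklore] -/
theorem P_self {k : ℕ} (r : Fin (k + 1) → V) :
    P b r r = P b (Fin.cons (r 0) (r ∘ Fin.succ)) (Fin.cons (r 0) (r ∘ Fin.succ)) := by
  have h : r = Fin.cons (r 0) (r ∘ Fin.succ) := (Fin.cons_self_tail r).symm
  conv_lhs => rw [h]

/-- size 0: `P(cons a !, cons c !) = b a c`. [folklore] -/
theorem P_cons_zero (a c : V) (r : Fin 0 → V) : P b (Fin.cons a r) (Fin.cons c r) = b a c := by
  unfold P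
  rw [Matrix.permanent_eq_elem_of_card_eq_one (by simp) 0]
  simp

end Permanent

section Hafnian

variable {W : Type*} [Fintype W] [DecidableEq W] [LinearOrder W]

omit [Fintype W] [DecidableEq W] [LinearOrder W] in
/-- `Asq_isSymm` (auxiliary). [folklore] -/
theorem Asq_isSymm (hanti : ∀ x y, b x y = - b y x) (p : W → V) : (Asq b p).IsSymm := by
  ext i j
  simp only [Asq, Matrix.transpose_apply, Matrix.of_apply]
  rw [hanti (p j) (p i), neg_sq]

/-- re-indexing a configuration along a strictly monotone bijection does not change `Hf`. [folklore] -/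
theorem Hf_reindex {W' : Type*} [Fintype W'] [DecidableEq W'] [LinearOrder W']
    (e : W' ≃ W) (he : StrictMono e) (p : W → V) : Hf b (p ∘ e) = Hf b p := by
  unfold Hf
  rw [← hafnian_submatrix_equiv e he (Asq b p)]
  rfl

/-- `haf` of the minor at `(a, c)` is `Hf` of the restricted configuration. [folklore] -/
theorem hafnian_minor_Asq (p : W → V) (a c : W) :
    hafnian (minor (Asq b p) a c) = Hf b (fun v : Compl2 a c => p v.val) := rfl

/-- the minor at `(c, a)` has the same hafnian as the minor at `(a, c)`. [folklore] -/
theorem hafnian_minor_swap (p : W → V) (a c : W) :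
    hafnian (minor (Asq b p) c a) = hafnian (minor (Asq b p) a c) := by
  rw [hafnian_minor_Asq, hafnian_minor_Asq]
  let e : Compl2 c a ≃ Compl2 a c :=
    { toFun := fun v => ⟨v.val, v.prop.2, v.prop.1⟩
      invFun := fun v => ⟨v.val, v.prop.2, v.prop.1⟩
      left_inv := fun v => rfl
      right_inv := fun v => rfl }
  have he : StrictMono e := fun x y h => h
  rw [← Hf_reindex b e he]
  rfl

omit [LinearOrder W] in
/-- `card_compl2` (auxiliary). [folklore] -/
theorem card_compl2 {n : ℕ} (a c : Fin n) (h : a ≠ c) :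
    Fintype.card (Compl2 a c) = n - 2 := by
  rw [Fintype.card_subtype]
  have hs : (univ.filter fun v : Fin n => v ≠ a ∧ v ≠ c) = univ \ {a, c} := by
    ext v
    simp only [Finset.mem_filter, Finset.mem_univ, true_and, Finset.mem_sdiff, Finset.mem_insert,
      Finset.mem_singleton, not_or]
  rw [hs, Finset.card_sdiff, Finset.inter_univ, Finset.card_univ, Fintype.card_fin,
    Finset.card_pair h]

/-- the strictly monotone enumeration of `Fin (k+2) ∖ {i, i.succAbove l}` by `Fin k`. [folklore] -/
def emb2 {k : ℕ} (i : Fin (k + 2)) (l : Fin (k + 1)) (t : Fin k) : Compl2 i (i.succAbove l) :=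
  ⟨i.succAbove (l.succAbove t), Fin.succAbove_ne i _,
    fun h => Fin.succAbove_ne l t (Fin.succAbove_right_injective h)⟩

/-- `emb2_strictMono` (auxiliary). [folklore] -/
theorem emb2_strictMono {k : ℕ} (i : Fin (k + 2)) (l : Fin (k + 1)) : StrictMono (emb2 i l) :=
  fun _ _ h => (Fin.strictMono_succAbove i) ((Fin.strictMono_succAbove l) h)

/-- `emb2_bijective` (auxiliary). [folklore] -/
theorem emb2_bijective {k : ℕ} (i : Fin (k + 2)) (l : Fin (k + 1)) :
    Function.Bijective (emb2 i l) := by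
  rw [Fintype.bijective_iff_injective_and_card]
  refine ⟨(emb2_strictMono i l).injective, ?_⟩
  rw [Fintype.card_fin, card_compl2 i (i.succAbove l) (Fin.succAbove_ne i l).symm]
  rfl

/-- `haf` of the minor at `(i, i.succAbove l)` = `Hf` of the doubly-deleted `Fin k`-configuration. [folklore] -/
theorem hafnian_minor_succAbove {k : ℕ} (r : Fin (k + 2) → V) (i : Fin (k + 2)) (l : Fin (k + 1)) :
    hafnian (minor (Asq b r) i (i.succAbove l)) =
      Hf b (fun t : Fin k => r (i.succAbove (l.succAbove t))) := by
  rw [hafnian_minor_Asq]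
  let e : Fin k ≃ Compl2 i (i.succAbove l) := Equiv.ofBijective (emb2 i l) (emb2_bijective i l)
  have he : StrictMono e := emb2_strictMono i l
  rw [← Hf_reindex b e he]
  rfl

/-- `Σ_{j ≠ 0} f j = Σ_i f (succ i)` on `Fin (k+1)`. [folklore] -/
theorem sum_erase_zero_eq {M : Type*} [AddCommGroup M] {k : ℕ} (f : Fin (k + 1) → M) :
    ∑ j ∈ univ.erase (0 : Fin (k + 1)), f j = ∑ i : Fin k, f i.succ := by
  have h1 := Finset.add_sum_erase (univ : Finset (Fin (k + 1))) f (Finset.mem_univ 0)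
  rw [Fin.sum_univ_succ] at h1
  exact add_left_cancel h1

/-- `Σ_{m ≠ i} g m = Σ_l g (i.succAbove l)` on `Fin (k+1)`. [folklore] -/
theorem sum_erase_eq_sum_succAbove {M : Type*} [AddCommGroup M] {k : ℕ} (g : Fin (k + 1) → M)
    (i : Fin (k + 1)) : ∑ m ∈ univ.erase i, g m = ∑ l : Fin k, g (i.succAbove l) := by
  have h1 := Finset.add_sum_erase (univ : Finset (Fin (k + 1))) g (Finset.mem_univ i)
  rw [Fin.sum_univ_succAbove g i] at h1
  exact add_left_cancel h1

/-- row-`0` expansion of `Hf` on `Fin (k+2)` in `succAbove` form. [folklore] -/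
theorem Hf_expand_zero {k : ℕ} (r : Fin (k + 2) → V) :
    Hf b r = ∑ i : Fin (k + 1), b (r 0) (r i.succ) ^ 2 *
      Hf b (fun t : Fin k => r (i.succAbove t).succ) := by
  unfold Hf
  rw [hafnian_fin_eq_sum_row_zero, sum_erase_zero_eq]
  refine Finset.sum_congr rfl fun i _ => ?_
  have h := hafnian_minor_succAbove b r 0 i
  exact congrArg₂ (· * ·) rfl h

/-- the EDGE-SUM identity: `Σ_a Σ_{c ≠ a} A a c · haf(A_{ac}) = n · haf A` for the (symmetric) squared-bracket matrix. [folklore] -/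
theorem sum_sum_erase_mul_hafnian_minor (hanti : ∀ x y, b x y = - b y x) (p : W → V) :
    ∑ a, ∑ c ∈ univ.erase a, Asq b p a c * hafnian (minor (Asq b p) a c) =
      (Fintype.card W : R) * Hf b p := by
  have h : ∀ a, ∑ c ∈ univ.erase a, Asq b p a c * hafnian (minor (Asq b p) a c) = Hf b p :=
    fun a => (hafnian_eq_sum_mul_hafnian_minor (Asq b p) (Asq_isSymm b hanti p) a).symm
  simp only [h, Finset.sum_const, Finset.card_univ, nsmul_eq_mul]

end Hafnian

end BracketPermanent

end Summit.Ventures.HSemireg
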